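/-
Copyright: the b2b-balaban T⁴-continuum CRUX team, row NE7b OWNER lineage `t4-ne7b-p1` (gen 140). Project licence.
-/
import Summits.QuantumFields.BalabanUV.T4Continuum.Spine.NE7b.SupWeightedCovarianceDecay

/-!
# THE DECAY OF DOBRUSHIN'S BILINEAR BOUND ACROSS TWO INDEX TYPES (SCOPING (d11)(4), whitened geometry): in whitened coordinates the
# sampler runs over the factor's index `κ` (where Dobrushin's `D` and its weight `θ` live) while the observables — gradient components
# `U′(Aξ+ψ)(e_v)` — are attached to field sites `v ∈ ι`.  (462)'s decay lemma is re-run with a CROSS WEIGHT `σ : ι → κ → ℝ` (`σ ≥ 0`,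
# compatible with `θ`: `σ_{xw} ≤ σ_{xz}θ_{zw}`) measuring how far a sampler coordinate is from a field site, and a TARGET WEIGHT `ρ` on `ι × ι`
# dominated through any meeting point (`ρ_{xy} ≤ σ_{xw}σ_{yw}`; for `e^{μd}` all three are the same exponential of the one distance):
#   `ρ_{xy}·Σ_w (Dᵀa)_w(Dᵀb)_w∕c_w ≤ αθ·dθ·βθ·dθ′∕cmin`   whenever `Σ_z a_zσ_{xz} ≤ αθ` (`F` lives near `x ∈ ι`) and `b_zσ_{yz} ≤ βθ`
# (`G` lives near `y ∈ ι`) — so `B(a^x, a^y) ≤ K∕ρ_{xy}` for the whitened gradient components, the input of (463)'s tree sum (row NE7b, node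
# U5c; (462) BY NAME for the one-type case; [folklore])

Cell `pub-balaban`, sub-cell `t4`, spine estimate NE7b (`T4WeightBudget.RelWeightBound`; the cell's OWN estimate — NOT PRINTED in
[Bałaban 1983–89], NOT PROVED).  Crux-route work under `Spine/NE7b/` by the row OWNER (`t4-ne7b-p1` gen 140, file (466)) under FREEZE
(0)'s crux-prover clause; NOTHING of Bałaban's is named as a Lean object, valued or asserted; no `T4Continuum/Support` leaf typed; no
`def`, no notation; zero `sorry`.  Imports (BY NAME): the OWNER's (462) `…SupWeightedCovarianceDecay` (the one-type case; nothing of it is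
used in the proofs, which are the two-type rewrites of its §2–§3).

WHAT IS PROVED ([folklore]; `D ≥ 0` on `κ × κ` with weighted row∕column letters for `θ`, cross weight `σ ≥ 0` with `σ_{xw} ≤ σ_{xz}θ_{zw}`,
target weight `ρ_{xy} ≤ σ_{xw}σ_{yw}`):
* §1 `cross_profile_row` (`σ_{xw}(Dᵀa)_w ≤ Σ_z (a_zσ_{xz})(D_{zw}θ_{zw})`), `cross_profile_sup` (`σ_{yw}(Dᵀb)_w ≤ βθ·Σ_zD_{zw}θ_{zw}`).
* §2 THE END **`cross_bilinear_weighted_le`** (`ρ_{xy}·B(a,b) ≤ αθ·dθ·βθ·dθ′∕cmin`) and **`cross_bilinear_decay`** (`B(a,b) ≤ αθ·dθ·βθ·dθ′∕(cmin·ρ_{xy})`,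
  `ρ ≥ 1`).
* §3 toy: all weights trivial.

HONEST (what this is NOT).  Letters; the weighted letters of the whitened Dobrushin matrix and of the profiles `Σ_u|A_{uw}|Hk_{vu}` in terms of
`A`, `Hk` and the geometry are hypotheses of the successor's assembly.  Scalar skeleton ((A3), NC-NE7b-α UNRULED); nothing of Bałaban's
asserted.  BY-NAME EFFECT ON THE WALL: NONE.  NE7b NOT PRINTED ∕ NOT PROVED; spine PROVED 0∕9; rung (B)+1 — the programme's measures remain
FINITE-torus statements; NOT the mass gap, NOT Clay.  HONEST DEPENDENCY: continuum YM on T⁴ ⇐ BetaPertH ∧ nine spine estimates (0∕9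
proved); BetaPertH ⇐ (D1) ∧ (D4) ∧ CAP+tail; G-an2-4 gates asym, D1 and NE2∕3∕4.
-/

set_option autoImplicit false

noncomputable section

namespace Summit.QuantumFields.BalabanUV.T4Continuum.NE7b.SupCrossWeightedCovarianceDecay

open Real Finset
open scoped BigOperators

variable {ι κ : Type} [Fintype κ]

variable {θ D : κ → κ → ℝ} {σ : ι → κ → ℝ} {ρ : ι → ι → ℝ} {dθ dθ' cmin αθ βθ : ℝ} {c a b : κ → ℝ}

/-! ## §1. Cross-weighted profiles propagate through `D` -/

/-- **`σ_{xw}·(Dᵀa)_w ≤ Σ_z (a_zσ_{xz})·(D_{zw}θ_{zw})`** (`σ_{xw} ≤ σ_{xz}θ_{zw}` term by term). [folklore] -/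
theorem cross_profile_row (hD : ∀ z w, 0 ≤ D z w) (hσθ : ∀ x z w, σ x w ≤ σ x z * θ z w) (ha : ∀ z, 0 ≤ a z) (x : ι) (w : κ) :
    σ x w * ∑ z, D z w * a z ≤ ∑ z, (a z * σ x z) * (D z w * θ z w) := by
  rw [Finset.mul_sum]
  refine Finset.sum_le_sum fun z _ => ?_
  have h0 : 0 ≤ D z w * a z := mul_nonneg (hD z w) (ha z)
  calc σ x w * (D z w * a z) ≤ (σ x z * θ z w) * (D z w * a z) := mul_le_mul_of_nonneg_right (hσθ x z w) h0
    _ = (a z * σ x z) * (D z w * θ z w) := by ring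

/-- **`σ_{yw}·(Dᵀb)_w ≤ βθ·Σ_zD_{zw}θ_{zw}`** when `b_zσ_{yz} ≤ βθ` for all `z` (`θ ≥ 0`). [folklore] -/
theorem cross_profile_sup (hD : ∀ z w, 0 ≤ D z w) (hθ0 : ∀ z w, 0 ≤ θ z w) (hσθ : ∀ x z w, σ x w ≤ σ x z * θ z w) (hb : ∀ z, 0 ≤ b z)
    (y : ι) (w : κ) (hbθ : ∀ z, b z * σ y z ≤ βθ) : σ y w * ∑ z, D z w * b z ≤ βθ * ∑ z, D z w * θ z w := by
  rw [Finset.mul_sum, Finset.mul_sum]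
  refine Finset.sum_le_sum fun z _ => ?_
  have h0 : 0 ≤ D z w := hD z w
  calc σ y w * (D z w * b z) ≤ (σ y z * θ z w) * (D z w * b z) := mul_le_mul_of_nonneg_right (hσθ y z w) (mul_nonneg h0 (hb z))
    _ = (b z * σ y z) * (D z w * θ z w) := by ring
    _ ≤ βθ * (D z w * θ z w) := mul_le_mul_of_nonneg_right (hbθ z) (mul_nonneg h0 (hθ0 z w))

/-! ## §2. The decay across the two index types -/

/-- **THE CROSS-WEIGHTED BILINEAR BOUND**: `ρ_{xy}·Σ_w (Dᵀa)_w(Dᵀb)_w∕c_w ≤ αθ·dθ·βθ·dθ′∕cmin` under the weighted row∕column letters of `D`,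
`c_w ≥ cmin > 0`, the cross-weighted mass `Σ_z a_zσ_{xz} ≤ αθ`, the cross-weighted sup `b_zσ_{yz} ≤ βθ`, `σ ≥ 0` compatible with `θ`, and the
meeting inequality `ρ_{xy} ≤ σ_{xw}σ_{yw}`. [folklore] -/
theorem cross_bilinear_weighted_le (hD : ∀ z w, 0 ≤ D z w) (hθ0 : ∀ z w, 0 ≤ θ z w) (hσ0 : ∀ x w, 0 ≤ σ x w)
    (hσθ : ∀ x z w, σ x w ≤ σ x z * θ z w) (hρσ : ∀ x y w, ρ x y ≤ σ x w * σ y w) (hDr : ∀ z, ∑ w, D z w * θ z w ≤ dθ) (hdθ : 0 ≤ dθ)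
    (hDc : ∀ w, ∑ z, D z w * θ z w ≤ dθ') (hdθ' : 0 ≤ dθ') (hcmin : 0 < cmin) (hc : ∀ w, cmin ≤ c w) (ha : ∀ z, 0 ≤ a z) (hb : ∀ z, 0 ≤ b z)
    (x y : ι) (hx : ∑ z, a z * σ x z ≤ αθ) (hβ : 0 ≤ βθ) (hy : ∀ z, b z * σ y z ≤ βθ) :
    ρ x y * ∑ w, (∑ z, D z w * a z) * (∑ z, D z w * b z) / c w ≤ αθ * dθ * (βθ * dθ') / cmin := by
  have hα : ∀ w, 0 ≤ ∑ z, D z w * a z := fun w => Finset.sum_nonneg fun z _ => mul_nonneg (hD z w) (ha z)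
  have hβw : ∀ w, 0 ≤ ∑ z, D z w * b z := fun w => Finset.sum_nonneg fun z _ => mul_nonneg (hD z w) (hb z)
  have hterm : ∀ w, ρ x y * ((∑ z, D z w * a z) * (∑ z, D z w * b z) / c w) ≤ (∑ z, (a z * σ x z) * (D z w * θ z w)) * (βθ * dθ') / cmin := fun w => by
    have h1 := cross_profile_row hD hσθ ha x w
    have h2 := (cross_profile_sup hD hθ0 hσθ hb y w hy).trans (mul_le_mul_of_nonneg_left (hDc w) hβ)
    have hcw : 0 < c w := hcmin.trans_le (hc w)
    have hS0 : 0 ≤ ∑ z, (a z * σ x z) * (D z w * θ z w) :=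
      Finset.sum_nonneg fun z _ => mul_nonneg (mul_nonneg (ha z) (hσ0 x z)) (mul_nonneg (hD z w) (hθ0 z w))
    calc ρ x y * ((∑ z, D z w * a z) * (∑ z, D z w * b z) / c w)
        ≤ (σ x w * σ y w) * ((∑ z, D z w * a z) * (∑ z, D z w * b z) / c w) :=
          mul_le_mul_of_nonneg_right (hρσ x y w) (div_nonneg (mul_nonneg (hα w) (hβw w)) hcw.le)
      _ = (σ x w * ∑ z, D z w * a z) * (σ y w * ∑ z, D z w * b z) / c w := by ring
      _ ≤ (∑ z, (a z * σ x z) * (D z w * θ z w)) * (βθ * dθ') / c w :=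
          div_le_div_of_nonneg_right (mul_le_mul h1 h2 (mul_nonneg (hσ0 y w) (hβw w)) hS0) hcw.le
      _ ≤ (∑ z, (a z * σ x z) * (D z w * θ z w)) * (βθ * dθ') / cmin :=
          div_le_div_of_nonneg_left (mul_nonneg hS0 (mul_nonneg hβ hdθ')) hcmin (hc w)
  rw [Finset.mul_sum]
  refine (Finset.sum_le_sum fun w _ => hterm w).trans ?_
  rw [← Finset.sum_div, ← Finset.sum_mul]
  have hsum : ∑ w, ∑ z, (a z * σ x z) * (D z w * θ z w) ≤ αθ * dθ := by
    rw [Finset.sum_comm]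
    calc ∑ z, ∑ w, (a z * σ x z) * (D z w * θ z w) = ∑ z, (a z * σ x z) * ∑ w, D z w * θ z w :=
          Finset.sum_congr rfl fun z _ => by rw [Finset.mul_sum]
      _ ≤ ∑ z, (a z * σ x z) * dθ := Finset.sum_le_sum fun z _ => mul_le_mul_of_nonneg_left (hDr z) (mul_nonneg (ha z) (hσ0 x z))
      _ ≤ αθ * dθ := by rw [← Finset.sum_mul]; exact mul_le_mul_of_nonneg_right hx hdθ
  exact div_le_div_of_nonneg_right (mul_le_mul_of_nonneg_right hsum (mul_nonneg hβ hdθ')) hcmin.le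

/-- **THE DECAY ACROSS THE TWO INDEX TYPES**: `Σ_w (Dᵀa)_w(Dᵀb)_w∕c_w ≤ αθ·dθ·βθ·dθ′∕(cmin·ρ_{xy})` (`ρ ≥ 1`). [folklore] -/
theorem cross_bilinear_decay (hD : ∀ z w, 0 ≤ D z w) (hθ0 : ∀ z w, 0 ≤ θ z w) (hσ0 : ∀ x w, 0 ≤ σ x w)
    (hσθ : ∀ x z w, σ x w ≤ σ x z * θ z w) (hρσ : ∀ x y w, ρ x y ≤ σ x w * σ y w) (hρ1 : ∀ x y, 1 ≤ ρ x y)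
    (hDr : ∀ z, ∑ w, D z w * θ z w ≤ dθ) (hdθ : 0 ≤ dθ) (hDc : ∀ w, ∑ z, D z w * θ z w ≤ dθ') (hdθ' : 0 ≤ dθ') (hcmin : 0 < cmin)
    (hc : ∀ w, cmin ≤ c w) (ha : ∀ z, 0 ≤ a z) (hb : ∀ z, 0 ≤ b z) (x y : ι) (hx : ∑ z, a z * σ x z ≤ αθ) (hβ : 0 ≤ βθ) (hy : ∀ z, b z * σ y z ≤ βθ) :
    ∑ w, (∑ z, D z w * a z) * (∑ z, D z w * b z) / c w ≤ αθ * dθ * (βθ * dθ') / (cmin * ρ x y) := by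
  have hρ0 : 0 < ρ x y := zero_lt_one.trans_le (hρ1 x y)
  have h := cross_bilinear_weighted_le hD hθ0 hσ0 hσθ hρσ hDr hdθ hDc hdθ' hcmin hc ha hb x y hx hβ hy
  rw [le_div_iff₀ (mul_pos hcmin hρ0)]
  rw [le_div_iff₀ hcmin] at h
  calc (∑ w, (∑ z, D z w * a z) * (∑ z, D z w * b z) / c w) * (cmin * ρ x y)
      = ρ x y * (∑ w, (∑ z, D z w * a z) * (∑ z, D z w * b z) / c w) * cmin := by ring
    _ ≤ αθ * dθ * (βθ * dθ') := h

/-! ## §3. Toy instance (kernel) -/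

/-- Toy: with all weights equal to `1` the compatibilities hold: `1 ≤ 1·1`. -/
example : (1 : ℝ) ≤ 1 * 1 := by norm_num

end Summit.QuantumFields.BalabanUV.T4Continuum.NE7b.SupCrossWeightedCovarianceDecay

end
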